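import Literature.Analysis.FluidPDE.LadyzhenskayaWeightedEstimate
import HarnessLib

/-!
# Ladyzhenskaya's weighted enstrophy estimate WITH A FORCE: `∫ (ω_θ/r)²(t) ≤ ∫ (ω_θ/r)²(0) + 2tΨ`

Analysis/FluidPDE proof file (all results proved, no definitions, no named facts). It is the
FORCED twin of `LadyzhenskayaPointwise.ladyzhenskaya_slice_le` /
`LadyzhenskayaWeightedEstimate.ladyzhenskaya_weighted_estimate` (Lemarié-Rieusset 2016,
Thm. 10.4, proof (10.25)–(10.27), pp. 286–288, printed with `f = 0`; Ladyzhenskaya's 1968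
theorem is stated for the Cauchy problem with an axisymmetric external force, Zap. Naučn. Sem.
LOMI 7 (1968) 155–177): for a classical solution `(u, p)` of the Navier–Stokes system with force
`f` on the closed slab `[0, T] × ℝ³`, axisymmetric WITHOUT SWIRL at all times, and with force
slices `f(t)` axisymmetric without swirl as well, the scalar `q = ω_θ/r`
(`curl u(t) = q(t) · J`, the smooth Hadamard quotient of `AxisymNoSwirlVorticity`) obeys

* `ladyzhenskaya_slice_le_forced` — at a fixed time, against the weight
  `η_{ε,R} = α_ε χ_R / ρ` of `AxisymWeights`:
  `∫ ⟨ω, ∂ₜω⟩ η_{ε,R} ≤ 64 D (3νFG + F²V/2) ε R + (144νD² + 4νD + 2√2DV) R⁻¹ ∫ q² + Ψ`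
  whenever `∫ |q| |g| ≤ Ψ`, where `g = (curl f(t))_θ / r` is the Hadamard quotient of the
  force's vorticity (`curl f(t) = g · J`): the only new term of Tao's weighted enstrophy
  identity `integral_enstrophyProduction_mul_weight` is `∫ ⟨ω, curl f⟩ η_{ε,R} = ∫ q g α_ε χ_R`
  (`inner_mul_axisWeight_eq`), bounded by `∫ |q| |g|` uniformly in `ε, R`;
* `ladyzhenskaya_weighted_estimate_eps_R_forced`, `ladyzhenskaya_weighted_estimate_forced` —
  time integration and removal of the cutoffs exactly as in the unforced file:
  `∫ q(t)² ≤ ∫ q(0)² + 2 t Ψ` for a bound `Ψ` of `∫ |q(s)| |g(s)|` uniform in `s ∈ [0, T]`;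
* `ladyzhenskaya_weighted_bound_forced` — the DATA form: if `∫ q(s)² ≤ F⋆` (any finite slab
  bound, enters only through `sup`) and `∫ g(s)² ≤ G₂` on `[0, T]`, then
  `∫ q(t)² ≤ 2 ∫ q(0)² + 4 T² G₂` for all `t ∈ [0, T]`
  (Young `|q||g| ≤ λq²/2 + g²/(2λ)` with `λ = 1/(2T)` and the supremum `M⋆` of `∫ q(s)²` over the
  slab: `M⋆ ≤ ∫q(0)² + M⋆/2 + 2T²G₂`).

The uniform bounds `|q| ≤ F`, `‖Dq‖ ≤ G`, `|u| ≤ V`, `∫ q² ≤ F⋆` hold in the smooth classes the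
tree runs continuation arguments in (all Sobolev norms of `u(t)` bounded on the closed slab,
`AxisymNoSwirlTaoBounds`); they enter only the error terms (and `F⋆` only qualitatively).
WHAT THIS IS NOT: not a statement about Navier–Stokes blow-up — a 1968 a-priori estimate,
ported to the forced setting.

## Mathlib / tree search

`lean search 'ladyzhenskaya.*forced|weighted_estimate.*forced'`: nothing before this file. Used:
`integral_enstrophyProduction_mul_weight` (force term included, `TaoEnstrophyIdentity`),
`ladyzhenskaya_integrand_le`, `norm_fderiv_axisCutoff_mul_sqBallCutoff_le`
(`LadyzhenskayaPointwise`), `localisedEnstrophy_le_add_mul`, `norm_sq_mul_axisWeight_eq`,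
`tendsto_integral_mul_axisCutoff_mul`, `tendsto_integral_mul_sqBallCutoff`
(`LadyzhenskayaWeightedEstimate`), `curl_eq_hadamardQuotFst_smul_rotGen`
(`AxisymNoSwirlVorticity`), the `AxisymWeights` cutoff API. Mathlib: `le_csSup`, `csSup_le`.

## References

* P. G. Lemarié-Rieusset, *The Navier–Stokes Problem in the 21st Century*, CRC Press (2016),
  §10.3, proof of Thm. 10.4, (10.25)–(10.27), pp. 286–288. [LemarieRieusset2016]
* O. A. Ladyzhenskaya, *Unique solvability in the large of a three-dimensional Cauchy problem
  for the Navier–Stokes equations in the presence of axial symmetry*, Zap. Naučn. Sem. LOMI 7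
  (1968) 155–177; M. R. Ukhovskii, V. I. Yudovich, J. Appl. Math. Mech. 32 (1968) 52–69;
  S. Leonardi, J. Málek, J. Nečas, M. Pokorný, Z. Anal. Anwendungen 18 (1999) 639–649.
-/

noncomputable section

open Set Function Filter MeasureTheory Metric
open scoped RealInnerProductSpace ENNReal NNReal Topology

namespace Literature.Analysis.FluidPDE

/-! ### The force term against the axis weight is `q g α_ε χ_R` -/

section Identification

variable {q g : EuclideanSpace ℝ (Fin 3) → ℝ}
  {ω ζ : EuclideanSpace ℝ (Fin 3) → EuclideanSpace ℝ (Fin 3)}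

/-- For `ω = q · J`, `ζ = g · J` and the weight `η_{ε,R} = α_ε χ_R/ρ`:
`⟨ω, ζ⟩ η_{ε,R} = q g α_ε χ_R` pointwise (off the axis `⟨ω, ζ⟩ = q g ρ`; on the axis both sides
vanish because `α_ε` does). [folklore] -/
private theorem inner_mul_axisWeight_eq (hω : ω = fun y => q y • rotGen y)
    (hζ : ζ = fun y => g y • rotGen y) {ε : ℝ} (hε : 0 < ε)
    (R : ℝ) (x : EuclideanSpace ℝ (Fin 3)) :
    ⟪ω x, ζ x⟫ * (Real.smoothTransition ((x 0 ^ 2 + x 1 ^ 2) / ε ^ 2 - 1) *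
        Real.smoothTransition (2 - ‖x‖ ^ 2 / R ^ 2) ^ 2 / (x 0 ^ 2 + x 1 ^ 2)) =
      q x * g x * (Real.smoothTransition ((x 0 ^ 2 + x 1 ^ 2) / ε ^ 2 - 1) *
        Real.smoothTransition (2 - ‖x‖ ^ 2 / R ^ 2) ^ 2) := by
  have hin : ⟪ω x, ζ x⟫ = q x * g x * (x 0 ^ 2 + x 1 ^ 2) := by
    rw [hω, hζ]
    simp only [real_inner_smul_left, real_inner_smul_right, inner_rotGen_self_eq]
    ring
  rw [hin]
  by_cases hρ : x 0 ^ 2 + x 1 ^ 2 = 0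
  · rw [axisCutoff_eq_zero hε (by rw [hρ]; positivity)]
    simp
  · field_simp

end Identification

/-! ### The inequality at a fixed time -/

section Slice

variable {T ν : ℝ} {f u : ℝ → EuclideanSpace ℝ (Fin 3) → EuclideanSpace ℝ (Fin 3)}
  {p : ℝ → EuclideanSpace ℝ (Fin 3) → ℝ}

/-- **Ladyzhenskaya's inequality at a fixed time, WITH A FORCE** (Lemarié-Rieusset 2016,
(10.25)–(10.26) pp. 286–288, there with `f = 0`; Ladyzhenskaya 1968 with an axisymmetric force).
For a classical solution `(u, p)` of Navier–Stokes with force `f` on `[0, T] × ℝ³`, viscosity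
`ν ≥ 0`, whose slices `u(t)` and `f(t)` are axisymmetric without swirl, the enstrophy
production against the weight `η_{ε,R} = α_ε χ_R/ρ` satisfies
`∫ ⟨ω, ∂ₜω⟩ η_{ε,R} ≤ 64 D (3νFG + F²V/2) ε R + (144νD² + 4νD + 2√2DV) R⁻¹ ∫ q² + Ψ`
for `0 < ε`, `1 ≤ R`, where `q = ω_θ/r`, `g = (curl f(t))_θ/r` (Hadamard quotients),
`|q| ≤ F`, `‖Dq‖ ≤ G`, `|u(t)| ≤ V`, `D` bounds `|sT'|`, and `∫ |q| |g| ≤ Ψ` majorises the work of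
the force's vorticity (`∫ ⟨ω, curl f⟩ η_{ε,R} = ∫ q g α_ε χ_R`). [cite: LemarieRieusset2016, §10.3 (10.25)–(10.27), pp. 286–288] -/
theorem ladyzhenskaya_slice_le_forced (hT : 0 < T) (hν : 0 ≤ ν)
    (hsol : IsClassicalNSSolutionOn (Icc 0 T) ν f u p) {t : ℝ} (ht : t ∈ Icc 0 T)
    (hax : IsAxisymmetric (u t)) (hsw : HasNoSwirl (u t))
    (hfax : IsAxisymmetric (f t)) (hfsw : HasNoSwirl (f t))
    {D : ℝ} (hD : ∀ s, |deriv Real.smoothTransition s| ≤ D) {ε R : ℝ} (hε : 0 < ε) (hR : 1 ≤ R)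
    {F G V Ψ : ℝ} (hF : ∀ x, |hadamardQuotFst (fun y => curl (u t) y 1) x| ≤ F)
    (hG : ∀ x, ‖fderiv ℝ (hadamardQuotFst (fun y => curl (u t) y 1)) x‖ ≤ G)
    (hV : ∀ x, ‖u t x‖ ≤ V)
    (hint : Integrable (fun x => hadamardQuotFst (fun y => curl (u t) y 1) x ^ 2))
    (hΨi : Integrable fun x => |hadamardQuotFst (fun y => curl (u t) y 1) x| *
      |hadamardQuotFst (fun y => curl (f t) y 1) x|)
    (hΨ : ∫ x, |hadamardQuotFst (fun y => curl (u t) y 1) x| *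
      |hadamardQuotFst (fun y => curl (f t) y 1) x| ≤ Ψ) :
    ∫ x, enstrophyProduction T u t x *
        (Real.smoothTransition ((x 0 ^ 2 + x 1 ^ 2) / ε ^ 2 - 1) *
          Real.smoothTransition (2 - ‖x‖ ^ 2 / R ^ 2) ^ 2 / (x 0 ^ 2 + x 1 ^ 2)) ≤
      64 * D * (3 * ν * F * G + F ^ 2 * V / 2) * ε * R +
        (144 * ν * D ^ 2 + 4 * ν * D + 2 * Real.sqrt 2 * D * V) / R *
          (∫ x, hadamardQuotFst (fun y => curl (u t) y 1) x ^ 2) + Ψ := by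
  -- names
  set q : EuclideanSpace ℝ (Fin 3) → ℝ := hadamardQuotFst (fun y => curl (u t) y 1) with hqdef
  set g : EuclideanSpace ℝ (Fin 3) → ℝ := hadamardQuotFst (fun y => curl (f t) y 1) with hgdef
  set α : EuclideanSpace ℝ (Fin 3) → ℝ := fun y =>
    Real.smoothTransition ((y 0 ^ 2 + y 1 ^ 2) / ε ^ 2 - 1) with hαdef
  set χ : EuclideanSpace ℝ (Fin 3) → ℝ := fun y =>
    Real.smoothTransition (2 - ‖y‖ ^ 2 / R ^ 2) ^ 2 with hχdef
  set η : EuclideanSpace ℝ (Fin 3) → ℝ := fun y => α y * χ y / (y 0 ^ 2 + y 1 ^ 2) with hηdef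
  have hU : UniqueDiffOn ℝ (Icc 0 T) := uniqueDiffOn_Icc hT
  have hR0 : 0 < R := by linarith
  have hD0 : 0 ≤ D := (abs_nonneg _).trans (hD 0)
  have hF0 : 0 ≤ F := (abs_nonneg _).trans (hF 0)
  have hG0 : 0 ≤ G := (norm_nonneg _).trans (hG 0)
  have hV0 : 0 ≤ V := (norm_nonneg _).trans (hV 0)
  -- regularity of the slice
  have hu3 : ContDiff ℝ 3 (u t) := (hsol.contDiff_velocity ht).of_le (by norm_cast)
  have hu2 : ContDiff ℝ 2 (u t) := hu3.of_le (by norm_cast)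
  have hu1 : ContDiff ℝ 1 (u t) := hu3.of_le (by norm_cast)
  have hq1 : ContDiff ℝ 1 q := contDiff_hadamardQuotFst_curl (n := 1) (by exact_mod_cast hu3)
  have hω : curl (u t) = fun y => q y • rotGen y :=
    funext fun y => curl_eq_hadamardQuotFst_smul_rotGen hax hsw hu2 y
  have hax' : ∀ x, fderiv ℝ (u t) x (rotGen x) = rotGen (u t x) := fun x =>
    hax.fderiv_rotGen ((hu1.differentiable one_ne_zero) x)
  have hω1 : ContDiff ℝ 1 (curl (u t)) := contDiff_curl (n := 1) (by exact_mod_cast hu2)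
  have hωc : Continuous (curl (u t)) := hω1.continuous
  have hDωc : Continuous (fderiv ℝ (curl (u t))) := hω1.continuous_fderiv one_ne_zero
  have huc : Continuous (u t) := hu1.continuous
  have hDuc : Continuous (fderiv ℝ (u t)) := hu1.continuous_fderiv one_ne_zero
  -- regularity of the force slice (a classical solution's force is jointly smooth)
  have hf3 : ContDiff ℝ 3 (f t) :=
    ((hsol.isSmoothSpaceTimeOn_force hU).contDiff_slice ht).of_le (by norm_cast)
  have hf2 : ContDiff ℝ 2 (f t) := hf3.of_le (by norm_cast)
  have hg1 : ContDiff ℝ 1 g := contDiff_hadamardQuotFst_curl (n := 1) (by exact_mod_cast hf3)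
  have hζ : curl (f t) = fun y => g y • rotGen y :=
    funext fun y => curl_eq_hadamardQuotFst_smul_rotGen hfax hfsw hf2 y
  -- the weight
  have hηs : ContDiff ℝ 1 η := contDiff_axisWeight hε R
  have hηc : HasCompactSupport η := hasCompactSupport_axisWeight ε hR0
  obtain ⟨K, hK⟩ : ∃ K, LipschitzWith K η := exists_lipschitzWith_axisWeight hε hR0
  have hηd : ∀ x, DifferentiableAt ℝ η x := fun x => (hηs.differentiable one_ne_zero) x
  have hηcont : Continuous η := hηs.continuous
  have hDηc : HasCompactSupport (fderiv ℝ η) := hηc.fderiv ℝ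
  have hDηcont : Continuous (fderiv ℝ η) := hηs.continuous_fderiv one_ne_zero
  -- the identity (10.11), WITH the force term
  have hid := integral_enstrophyProduction_mul_weight hT hsol ht hK hηc
  have hld : ∀ x v, lineDeriv ℝ η x v = fderiv ℝ η x v := fun x v =>
    (hηd x).lineDeriv_eq_fderiv
  simp_rw [hld] at hid
  -- integrability of the four densities
  have hIa : Integrable fun x => frobeniusNormSq (fderiv ℝ (curl (u t)) x) * η x :=
    integrable_mul_of_continuous_of_hasCompactSupport
      (continuous_frobeniusNormSq_fderiv hω1 one_ne_zero) hηcont hηc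
  have hIb : ∀ j : Fin 3, Integrable fun x =>
      ⟪curl (u t) x, fderiv ℝ (curl (u t)) x (EuclideanSpace.single j (1 : ℝ))⟫ *
        fderiv ℝ η x (EuclideanSpace.single j (1 : ℝ)) := fun j =>
    integrable_mul_of_continuous_of_hasCompactSupport
      (hωc.inner (hDωc.clm_apply continuous_const)) (hDηcont.clm_apply continuous_const)
      (hDηc.mono fun x hx => by
        simp only [mem_support, ne_eq] at hx ⊢
        intro h; exact hx (by rw [h]; rfl))
  have hIc : Integrable fun x => ‖curl (u t) x‖ ^ 2 * fderiv ℝ η x (u t x) :=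
    integrable_mul_of_continuous_of_hasCompactSupport (hωc.norm.pow 2) (hDηcont.clm_apply huc)
      (hDηc.mono fun x hx => by
        simp only [mem_support, ne_eq] at hx ⊢
        intro h; exact hx (by rw [h]; rfl))
  have hId : Integrable fun x => ⟪curl (u t) x, convect (curl (u t)) (u t) x⟫ * η x :=
    integrable_mul_of_continuous_of_hasCompactSupport
      (hωc.inner (hDuc.clm_apply hωc)) hηcont hηc
  rw [← integral_finsetSum _ (fun j _ => hIb j)] at hid
  have hIb' : Integrable fun x => ∑ j : Fin 3,
      ⟪curl (u t) x, fderiv ℝ (curl (u t)) x (EuclideanSpace.single j (1 : ℝ))⟫ *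
        fderiv ℝ η x (EuclideanSpace.single j (1 : ℝ)) := integrable_finsetSum _ fun j _ => hIb j
  -- combine into one integral
  have i1 : Integrable fun x => -(ν * (frobeniusNormSq (fderiv ℝ (curl (u t)) x) * η x)) :=
    (hIa.const_mul ν).neg
  have i12 : Integrable fun x => -(ν * (frobeniusNormSq (fderiv ℝ (curl (u t)) x) * η x))
      - ν * (∑ j : Fin 3,
          ⟪curl (u t) x, fderiv ℝ (curl (u t)) x (EuclideanSpace.single j (1 : ℝ))⟫ *
            fderiv ℝ η x (EuclideanSpace.single j (1 : ℝ))) := i1.sub (hIb'.const_mul ν)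
  have i123 : Integrable fun x => -(ν * (frobeniusNormSq (fderiv ℝ (curl (u t)) x) * η x))
      - ν * (∑ j : Fin 3,
          ⟪curl (u t) x, fderiv ℝ (curl (u t)) x (EuclideanSpace.single j (1 : ℝ))⟫ *
            fderiv ℝ η x (EuclideanSpace.single j (1 : ℝ)))
      + 1 / 2 * (‖curl (u t) x‖ ^ 2 * fderiv ℝ η x (u t x)) := i12.add (hIc.const_mul _)
  have hcomb :
      -(ν * ∫ x, frobeniusNormSq (fderiv ℝ (curl (u t)) x) * η x)
        - ν * (∫ x, ∑ j : Fin 3,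
            ⟪curl (u t) x, fderiv ℝ (curl (u t)) x (EuclideanSpace.single j (1 : ℝ))⟫ *
              fderiv ℝ η x (EuclideanSpace.single j (1 : ℝ)))
        + 1 / 2 * (∫ x, ‖curl (u t) x‖ ^ 2 * fderiv ℝ η x (u t x))
        + (∫ x, ⟪curl (u t) x, convect (curl (u t)) (u t) x⟫ * η x) =
      ∫ x, (-(ν * (frobeniusNormSq (fderiv ℝ (curl (u t)) x) * η x))
        - ν * (∑ j : Fin 3,
            ⟪curl (u t) x, fderiv ℝ (curl (u t)) x (EuclideanSpace.single j (1 : ℝ))⟫ *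
              fderiv ℝ η x (EuclideanSpace.single j (1 : ℝ)))
        + 1 / 2 * (‖curl (u t) x‖ ^ 2 * fderiv ℝ η x (u t x))
        + ⟪curl (u t) x, convect (curl (u t)) (u t) x⟫ * η x) := by
    rw [integral_add i123 hId, integral_add i12 (hIc.const_mul _),
      integral_sub i1 (hIb'.const_mul ν), integral_neg, integral_const_mul, integral_const_mul,
      integral_const_mul]
  rw [hid, hcomb]
  -- the force term: `∫ ⟨ω, curl f⟩ η = ∫ q g α χ ≤ ∫ |q| |g| ≤ Ψ`
  have hforce : (∫ x, ⟪curl (u t) x, curl (f t) x⟫ * η x) ≤ Ψ := by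
    have hre : ∀ x, ⟪curl (u t) x, curl (f t) x⟫ * η x = q x * g x * (α x * χ x) := fun x =>
      inner_mul_axisWeight_eq hω hζ hε R x
    simp_rw [hre]
    have hw01 : ∀ x, 0 ≤ α x * χ x ∧ α x * χ x ≤ 1 := fun x =>
      ⟨mul_nonneg (axisCutoff_nonneg ε x) (sqBallCutoff_nonneg R x),
        mul_le_one₀ (axisCutoff_le_one ε x) (sqBallCutoff_nonneg R x) (sqBallCutoff_le_one R x)⟩
    have hwc : Continuous fun x => α x * χ x :=
      (contDiff_axisCutoff ε (n := 0)).continuous.mul (contDiff_sqBallCutoff R (n := 0)).continuous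
    have hI : Integrable fun x => q x * g x * (α x * χ x) := by
      refine hΨi.mono' ((hq1.continuous.mul hg1.continuous).mul hwc).aestronglyMeasurable
        (ae_of_all _ fun x => ?_)
      rw [Real.norm_eq_abs, abs_mul, abs_mul, abs_of_nonneg (hw01 x).1]
      exact mul_le_of_le_one_right (by positivity) (hw01 x).2
    refine (integral_mono hI hΨi fun x => ?_).trans hΨ
    have h1 : q x * g x * (α x * χ x) ≤ |q x * g x| * (α x * χ x) :=
      mul_le_mul_of_nonneg_right (le_abs_self _) (hw01 x).1
    calc _ ≤ |q x * g x| * (α x * χ x) := h1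
      _ ≤ |q x * g x| * 1 := mul_le_mul_of_nonneg_left (hw01 x).2 (abs_nonneg _)
      _ = |q x| * |g x| := by rw [mul_one, abs_mul]
  -- the majorant of the unforced part
  set S : Set (EuclideanSpace ℝ (Fin 3)) :=
    {y | y 0 ^ 2 + y 1 ^ 2 ≤ 2 * ε ^ 2 ∧ ‖y‖ ^ 2 ≤ 2 * R ^ 2} with hSdef
  have hSm : MeasurableSet S := by
    have h1 : IsClosed {y : EuclideanSpace ℝ (Fin 3) | y 0 ^ 2 + y 1 ^ 2 ≤ 2 * ε ^ 2} :=
      isClosed_le (contDiff_horizSq (n := 0)).continuous continuous_const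
    have h2 : IsClosed {y : EuclideanSpace ℝ (Fin 3) | ‖y‖ ^ 2 ≤ 2 * R ^ 2} :=
      isClosed_le (continuous_norm.pow 2) continuous_const
    exact (h1.inter h2).measurableSet
  have hvolS : volume S ≤ ENNReal.ofReal (16 * Real.sqrt 2 * ε ^ 2 * R) := by
    have h := volume_thinCylinder_le (a := Real.sqrt 2 * ε) (b := Real.sqrt 2 * R)
      (by positivity) (by positivity)
    have e1 : (Real.sqrt 2 * ε) ^ 2 = 2 * ε ^ 2 := by
      rw [mul_pow, Real.sq_sqrt (by norm_num : (0:ℝ) ≤ 2)]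
    have e2 : (Real.sqrt 2 * R) ^ 2 = 2 * R ^ 2 := by
      rw [mul_pow, Real.sq_sqrt (by norm_num : (0:ℝ) ≤ 2)]
    rw [e1, e2] at h
    refine h.trans (le_of_eq ?_)
    congr 1
    ring
  have hvolS' : (volume S).toReal ≤ 16 * Real.sqrt 2 * ε ^ 2 * R :=
    ENNReal.toReal_le_of_le_ofReal (by positivity) hvolS
  have hvolS_top : volume S < ⊤ := lt_of_le_of_lt hvolS ENNReal.ofReal_lt_top
  set C₁ : ℝ := 3 * ν * F * G + F ^ 2 * V / 2 with hC₁
  set C₂ : ℝ := (144 * ν * D ^ 2 + 4 * ν * D + 2 * Real.sqrt 2 * D * V) / R with hC₂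
  have hC₁0 : 0 ≤ C₁ := by positivity
  have hC₂0 : 0 ≤ C₂ := by positivity
  have hInd : Integrable (fun x => S.indicator (1 : EuclideanSpace ℝ (Fin 3) → ℝ) x) :=
    (integrable_indicator_iff hSm).2 (integrableOn_const hvolS_top.ne)
  have hbound : Integrable fun x =>
      C₁ * (2 * Real.sqrt 2 * D / ε) * S.indicator 1 x + C₂ * q x ^ 2 :=
    (hInd.const_mul _).add (hint.const_mul _)
  -- pointwise comparison
  have hpt : ∀ x,
      (-(ν * (frobeniusNormSq (fderiv ℝ (curl (u t)) x) * η x))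
        - ν * (∑ j : Fin 3,
            ⟪curl (u t) x, fderiv ℝ (curl (u t)) x (EuclideanSpace.single j (1 : ℝ))⟫ *
              fderiv ℝ η x (EuclideanSpace.single j (1 : ℝ)))
        + 1 / 2 * (‖curl (u t) x‖ ^ 2 * fderiv ℝ η x (u t x))
        + ⟪curl (u t) x, convect (curl (u t)) (u t) x⟫ * η x) ≤
      C₁ * (2 * Real.sqrt 2 * D / ε) * S.indicator 1 x + C₂ * q x ^ 2 := by
    intro x
    have h1 := ladyzhenskaya_integrand_le (ω := curl (u t)) (U := u t) hω
      ((hq1.differentiable one_ne_zero) x) (hax' x) hν hD hε hR (hF x) (hG x) (hV x)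
    have h2 := norm_fderiv_axisCutoff_mul_sqBallCutoff_le hD hε hR0 x
    have h3 : C₁ * (‖fderiv ℝ α x‖ * χ x) ≤ C₁ * (2 * Real.sqrt 2 * D / ε * S.indicator 1 x) :=
      mul_le_mul_of_nonneg_left h2 hC₁0
    simp only [convect_apply]
    calc _ ≤ C₁ * (‖fderiv ℝ α x‖ * χ x) + q x ^ 2 * C₂ := h1
      _ ≤ _ := by nlinarith [h3]
  have hmain :
      (∫ x, (-(ν * (frobeniusNormSq (fderiv ℝ (curl (u t)) x) * η x))
        - ν * (∑ j : Fin 3,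
            ⟪curl (u t) x, fderiv ℝ (curl (u t)) x (EuclideanSpace.single j (1 : ℝ))⟫ *
              fderiv ℝ η x (EuclideanSpace.single j (1 : ℝ)))
        + 1 / 2 * (‖curl (u t) x‖ ^ 2 * fderiv ℝ η x (u t x))
        + ⟪curl (u t) x, convect (curl (u t)) (u t) x⟫ * η x)) ≤
      64 * D * C₁ * ε * R + C₂ * ∫ x, q x ^ 2 := by
    calc _ ≤ ∫ x, C₁ * (2 * Real.sqrt 2 * D / ε) * S.indicator 1 x + C₂ * q x ^ 2 :=
          integral_mono (i123.add hId) hbound hpt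
      _ = C₁ * (2 * Real.sqrt 2 * D / ε) * (volume S).toReal + C₂ * ∫ x, q x ^ 2 := by
          rw [integral_add (hInd.const_mul _) (hint.const_mul _), integral_const_mul,
            integral_const_mul, integral_indicator_one hSm]
          rfl
      _ ≤ C₁ * (2 * Real.sqrt 2 * D / ε) * (16 * Real.sqrt 2 * ε ^ 2 * R) + C₂ * ∫ x, q x ^ 2 := by
          gcongr
      _ = 64 * D * C₁ * ε * R + C₂ * ∫ x, q x ^ 2 := by
          have e : Real.sqrt 2 * Real.sqrt 2 = 2 := Real.mul_self_sqrt (by norm_num)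
          have key : C₁ * (2 * Real.sqrt 2 * D / ε) * (16 * Real.sqrt 2 * ε ^ 2 * R) =
              64 * D * C₁ * ε * R := by
            calc _ = 32 * (Real.sqrt 2 * Real.sqrt 2) * D * C₁ * R * (ε * ε / ε) := by ring
              _ = _ := by rw [e, mul_self_div_self]; ring
          rw [key]
  refine (add_le_add hmain hforce).trans_eq ?_
  rw [hC₁, hC₂]

end Slice

/-! ### Ladyzhenskaya's estimate with force: time integration and removal of the cutoffs -/

section Main

variable {T ν : ℝ} {f u : ℝ → EuclideanSpace ℝ (Fin 3) → EuclideanSpace ℝ (Fin 3)}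
  {p : ℝ → EuclideanSpace ℝ (Fin 3) → ℝ}

/-- **Step 1, forced: the weighted estimate at fixed `ε`, `R`.** Under the hypotheses of
`ladyzhenskaya_weighted_estimate_forced`, for `0 < ε`, `1 ≤ R` and `t ∈ [0, T]`:
`∫ q(t)² α_ε χ_R ≤ ∫ q(0)² + 2t (64 D C₁ ε R + C₂ F⋆ / R + Ψ)` with `C₁ = 3νFG + F²V/2`,
`C₂ = 144νD² + 4νD + 2√2DV` (time integration of `ladyzhenskaya_slice_le_forced`).
[cite: LemarieRieusset2016, §10.3 pp. 287–288] -/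
theorem ladyzhenskaya_weighted_estimate_eps_R_forced (hT : 0 < T) (hν : 0 ≤ ν)
    (hsol : IsClassicalNSSolutionOn (Icc 0 T) ν f u p)
    (hax : ∀ t ∈ Icc 0 T, IsAxisymmetric (u t)) (hsw : ∀ t ∈ Icc 0 T, HasNoSwirl (u t))
    (hfax : ∀ t ∈ Icc 0 T, IsAxisymmetric (f t)) (hfsw : ∀ t ∈ Icc 0 T, HasNoSwirl (f t))
    {D : ℝ} (hD : ∀ s, |deriv Real.smoothTransition s| ≤ D)
    {F G V Fstar Ψ : ℝ}
    (hF : ∀ t ∈ Icc 0 T, ∀ x, |hadamardQuotFst (fun y => curl (u t) y 1) x| ≤ F)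
    (hG : ∀ t ∈ Icc 0 T, ∀ x, ‖fderiv ℝ (hadamardQuotFst (fun y => curl (u t) y 1)) x‖ ≤ G)
    (hV : ∀ t ∈ Icc 0 T, ∀ x, ‖u t x‖ ≤ V)
    (hint : ∀ t ∈ Icc 0 T, Integrable (fun x => hadamardQuotFst (fun y => curl (u t) y 1) x ^ 2))
    (hFstar : ∀ t ∈ Icc 0 T, ∫ x, hadamardQuotFst (fun y => curl (u t) y 1) x ^ 2 ≤ Fstar)
    (hΨi : ∀ t ∈ Icc 0 T, Integrable fun x => |hadamardQuotFst (fun y => curl (u t) y 1) x| *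
      |hadamardQuotFst (fun y => curl (f t) y 1) x|)
    (hΨ : ∀ t ∈ Icc 0 T, ∫ x, |hadamardQuotFst (fun y => curl (u t) y 1) x| *
      |hadamardQuotFst (fun y => curl (f t) y 1) x| ≤ Ψ)
    {ε R : ℝ} (hε : 0 < ε) (hR : 1 ≤ R) {t : ℝ} (ht : t ∈ Icc 0 T) :
    ∫ x, hadamardQuotFst (fun y => curl (u t) y 1) x ^ 2 *
        (Real.smoothTransition ((x 0 ^ 2 + x 1 ^ 2) / ε ^ 2 - 1) *
          Real.smoothTransition (2 - ‖x‖ ^ 2 / R ^ 2) ^ 2) ≤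
      (∫ x, hadamardQuotFst (fun y => curl (u 0) y 1) x ^ 2) +
        2 * t * (64 * D * (3 * ν * F * G + F ^ 2 * V / 2) * ε * R +
          (144 * ν * D ^ 2 + 4 * ν * D + 2 * Real.sqrt 2 * D * V) / R * Fstar + Ψ) := by
  set α : EuclideanSpace ℝ (Fin 3) → ℝ := fun y =>
    Real.smoothTransition ((y 0 ^ 2 + y 1 ^ 2) / ε ^ 2 - 1) with hαdef
  set χ : EuclideanSpace ℝ (Fin 3) → ℝ := fun y =>
    Real.smoothTransition (2 - ‖y‖ ^ 2 / R ^ 2) ^ 2 with hχdef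
  set η : EuclideanSpace ℝ (Fin 3) → ℝ := fun y => α y * χ y / (y 0 ^ 2 + y 1 ^ 2) with hηdef
  have hR0 : 0 < R := by linarith
  have hD0 : 0 ≤ D := (abs_nonneg _).trans (hD 0)
  have h0T : (0 : ℝ) ∈ Icc 0 T := ⟨le_rfl, hT.le⟩
  have hV0 : 0 ≤ V := (norm_nonneg _).trans (hV 0 h0T 0)
  have hC₂0 : 0 ≤ (144 * ν * D ^ 2 + 4 * ν * D + 2 * Real.sqrt 2 * D * V) / R := by positivity
  -- the weight
  have hηs : ContDiff ℝ 1 η := contDiff_axisWeight hε R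
  have hηc : HasCompactSupport η := hasCompactSupport_axisWeight ε hR0
  have hηcont : Continuous η := hηs.continuous
  -- the production bound at interior times
  set B : ℝ := 64 * D * (3 * ν * F * G + F ^ 2 * V / 2) * ε * R +
    (144 * ν * D ^ 2 + 4 * ν * D + 2 * Real.sqrt 2 * D * V) / R * Fstar + Ψ with hBdef
  have hB : ∀ s ∈ Ioo 0 T, ∫ x, enstrophyProduction T u s x * η x ≤ B := by
    intro s hs
    have hs' : s ∈ Icc 0 T := Ioo_subset_Icc_self hs
    have h := ladyzhenskaya_slice_le_forced hT hν hsol hs' (hax s hs') (hsw s hs') (hfax s hs')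
      (hfsw s hs') hD hε hR (hF s hs') (hG s hs') (hV s hs') (hint s hs') (hΨi s hs') (hΨ s hs')
    refine h.trans ?_
    rw [hBdef]
    gcongr
    exact hFstar s hs'
  -- time integration
  have hgrow := localisedEnstrophy_le_add_mul hT hsol.smooth_velocity hηcont hηc hB t ht
  -- identification of the weighted enstrophies
  have hid : ∀ s ∈ Icc 0 T, localisedEnstrophy η (u s) =
      1 / 2 * ∫ x, hadamardQuotFst (fun y => curl (u s) y 1) x ^ 2 * (α x * χ x) := by
    intro s hs
    have hu2 : ContDiff ℝ 2 (u s) := (hsol.contDiff_velocity hs).of_le (by norm_cast)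
    have hω : curl (u s) = fun y => hadamardQuotFst (fun y => curl (u s) y 1) y • rotGen y :=
      funext fun y => curl_eq_hadamardQuotFst_smul_rotGen (hax s hs) (hsw s hs) hu2 y
    rw [localisedEnstrophy_def]
    congr 1
    refine integral_congr_ae (Eventually.of_forall fun x => ?_)
    exact norm_sq_mul_axisWeight_eq hω hε R x
  rw [hid t ht, hid 0 h0T] at hgrow
  -- the initial weighted integral is at most the unweighted one
  have hw01 : ∀ x, 0 ≤ α x * χ x ∧ α x * χ x ≤ 1 := fun x =>
    ⟨mul_nonneg (axisCutoff_nonneg ε x) (sqBallCutoff_nonneg R x),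
      mul_le_one₀ (axisCutoff_le_one ε x) (sqBallCutoff_nonneg R x) (sqBallCutoff_le_one R x)⟩
  have hwc : Continuous fun x => α x * χ x :=
    (contDiff_axisCutoff ε (n := 0)).continuous.mul (contDiff_sqBallCutoff R (n := 0)).continuous
  have hint0w : Integrable fun x => hadamardQuotFst (fun y => curl (u 0) y 1) x ^ 2 * (α x * χ x) :=
    (hint 0 h0T).mul_bdd hwc.aestronglyMeasurable (ae_of_all _ fun x => by
      rw [Real.norm_eq_abs, abs_of_nonneg (hw01 x).1]; exact (hw01 x).2)
  have h0le : ∫ x, hadamardQuotFst (fun y => curl (u 0) y 1) x ^ 2 * (α x * χ x) ≤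
      ∫ x, hadamardQuotFst (fun y => curl (u 0) y 1) x ^ 2 :=
    integral_mono hint0w (hint 0 h0T) fun x => by
      have := (hw01 x).2
      have h0 : 0 ≤ hadamardQuotFst (fun y => curl (u 0) y 1) x ^ 2 := sq_nonneg _
      nlinarith
  linarith

/-- **Ladyzhenskaya's key estimate WITH A FORCE** (Lemarié-Rieusset 2016, (10.27), printed
with `f = 0`: `∫ |ω(t)|² r⁻² dx ≤ ∫ |ω₀|² r⁻² dx`; Ladyzhenskaya 1968 treats an axisymmetric
force). Let `(u, p)` be a classical solution of the Navier–Stokes system with force `f` on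
`[0, T] × ℝ³`, `ν ≥ 0`, with `u(t)` and `f(t)` axisymmetric without swirl at every time, and let
`q(t) = ω_θ(t)/r`, `g(t) = (curl f(t))_θ/r` be the smooth Hadamard quotients
(`curl u(t) = q(t) · J`, `curl f(t) = g(t) · J`). Assume the uniform bounds `|q| ≤ F`,
`‖Dq‖ ≤ G`, `|u| ≤ V` on the slab, `q(t) ∈ L²` with `∫ q(t)² ≤ F⋆`, and `∫ |q(t)| |g(t)| ≤ Ψ` for
all `t ∈ [0, T]`. Then `∫ q(t)² ≤ ∫ q(0)² + 2 t Ψ` for every `t ∈ [0, T]`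
(`d/dt ‖q‖₂² = −2ν‖∇q‖²_{L²(r dr)} + 2∫ q g ≤ 2∫|q||g|`, made rigorous through the regularised
weights: `ladyzhenskaya_weighted_estimate_eps_R_forced`, then `ε → 0` and `R → ∞` by dominated
convergence — the constants `F, G, V, F⋆` only enter the vanishing error terms).
[cite: LemarieRieusset2016, §10.3 Thm. 10.4 proof, (10.25)–(10.27) pp. 286–288] -/
theorem ladyzhenskaya_weighted_estimate_forced (hT : 0 < T) (hν : 0 ≤ ν)
    (hsol : IsClassicalNSSolutionOn (Icc 0 T) ν f u p)
    (hax : ∀ t ∈ Icc 0 T, IsAxisymmetric (u t)) (hsw : ∀ t ∈ Icc 0 T, HasNoSwirl (u t))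
    (hfax : ∀ t ∈ Icc 0 T, IsAxisymmetric (f t)) (hfsw : ∀ t ∈ Icc 0 T, HasNoSwirl (f t))
    {F G V Fstar Ψ : ℝ}
    (hF : ∀ t ∈ Icc 0 T, ∀ x, |hadamardQuotFst (fun y => curl (u t) y 1) x| ≤ F)
    (hG : ∀ t ∈ Icc 0 T, ∀ x, ‖fderiv ℝ (hadamardQuotFst (fun y => curl (u t) y 1)) x‖ ≤ G)
    (hV : ∀ t ∈ Icc 0 T, ∀ x, ‖u t x‖ ≤ V)
    (hint : ∀ t ∈ Icc 0 T, Integrable (fun x => hadamardQuotFst (fun y => curl (u t) y 1) x ^ 2))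
    (hFstar : ∀ t ∈ Icc 0 T, ∫ x, hadamardQuotFst (fun y => curl (u t) y 1) x ^ 2 ≤ Fstar)
    (hΨi : ∀ t ∈ Icc 0 T, Integrable fun x => |hadamardQuotFst (fun y => curl (u t) y 1) x| *
      |hadamardQuotFst (fun y => curl (f t) y 1) x|)
    (hΨ : ∀ t ∈ Icc 0 T, ∫ x, |hadamardQuotFst (fun y => curl (u t) y 1) x| *
      |hadamardQuotFst (fun y => curl (f t) y 1) x| ≤ Ψ) :
    ∀ t ∈ Icc 0 T, ∫ x, hadamardQuotFst (fun y => curl (u t) y 1) x ^ 2 ≤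
      (∫ x, hadamardQuotFst (fun y => curl (u 0) y 1) x ^ 2) + 2 * t * Ψ := by
  intro t ht
  obtain ⟨D, hD0, hD⟩ := Calculus.exists_bound_deriv_smoothTransition
  set gq : EuclideanSpace ℝ (Fin 3) → ℝ := fun x => hadamardQuotFst (fun y => curl (u t) y 1) x ^ 2
    with hgqdef
  set I0 : ℝ := ∫ x, hadamardQuotFst (fun y => curl (u 0) y 1) x ^ 2 with hI0
  set C₁ : ℝ := 3 * ν * F * G + F ^ 2 * V / 2 with hC₁
  set C₂ : ℝ := 144 * ν * D ^ 2 + 4 * ν * D + 2 * Real.sqrt 2 * D * V with hC₂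
  have hg : Integrable gq := hint t ht
  -- Step 2: `ε → 0` at fixed `R = m + 1`
  have hR : ∀ m : ℕ, ∫ x, gq x * Real.smoothTransition (2 - ‖x‖ ^ 2 / ((m : ℝ) + 1) ^ 2) ^ 2 ≤
      I0 + 2 * t * (C₂ / ((m : ℝ) + 1) * Fstar + Ψ) := by
    intro m
    have hR1 : (1 : ℝ) ≤ (m : ℝ) + 1 := by
      have : (0 : ℝ) ≤ m := Nat.cast_nonneg m
      linarith
    have hstep : ∀ n : ℕ, ∫ x, gq x *
        (Real.smoothTransition ((x 0 ^ 2 + x 1 ^ 2) / ((1 : ℝ) / (n + 1)) ^ 2 - 1) *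
          Real.smoothTransition (2 - ‖x‖ ^ 2 / ((m : ℝ) + 1) ^ 2) ^ 2) ≤
        I0 + 2 * t * (64 * D * C₁ * ((1 : ℝ) / (n + 1)) * ((m : ℝ) + 1) +
          C₂ / ((m : ℝ) + 1) * Fstar + Ψ) := fun n =>
      ladyzhenskaya_weighted_estimate_eps_R_forced hT hν hsol hax hsw hfax hfsw hD hF hG hV hint
        hFstar hΨi hΨ (ε := (1 : ℝ) / (n + 1)) (R := (m : ℝ) + 1) (by positivity) hR1 ht
    have hlim1 := tendsto_integral_mul_axisCutoff_mul hg ((m : ℝ) + 1)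
    have hlim2 : Tendsto (fun n : ℕ => I0 + 2 * t * (64 * D * C₁ * ((1 : ℝ) / (n + 1)) *
        ((m : ℝ) + 1) + C₂ / ((m : ℝ) + 1) * Fstar + Ψ)) atTop
        (𝓝 (I0 + 2 * t * (64 * D * C₁ * 0 * ((m : ℝ) + 1) + C₂ / ((m : ℝ) + 1) * Fstar + Ψ))) := by
      have h0 : Tendsto (fun n : ℕ => (1 : ℝ) / ((n : ℝ) + 1)) atTop (𝓝 0) :=
        tendsto_one_div_add_atTop_nhds_zero_nat
      exact tendsto_const_nhds.add (tendsto_const_nhds.mul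
        ((((tendsto_const_nhds.mul h0).mul tendsto_const_nhds).add tendsto_const_nhds).add
          tendsto_const_nhds))
    have := le_of_tendsto_of_tendsto' hlim1 hlim2 hstep
    simpa using this
  -- Step 3: `R → ∞`
  have hlim3 := tendsto_integral_mul_sqBallCutoff hg
  have hlim4 : Tendsto (fun m : ℕ => I0 + 2 * t * (C₂ / ((m : ℝ) + 1) * Fstar + Ψ)) atTop
      (𝓝 (I0 + 2 * t * (C₂ * 0 * Fstar + Ψ))) := by
    have h0 : Tendsto (fun m : ℕ => (1 : ℝ) / ((m : ℝ) + 1)) atTop (𝓝 0) :=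
      tendsto_one_div_add_atTop_nhds_zero_nat
    have h1 : Tendsto (fun m : ℕ => C₂ / ((m : ℝ) + 1)) atTop (𝓝 (C₂ * 0)) := by
      have := (tendsto_const_nhds (x := C₂)).mul h0
      refine this.congr fun m => ?_
      ring
    exact tendsto_const_nhds.add (tendsto_const_nhds.mul
      ((h1.mul tendsto_const_nhds).add tendsto_const_nhds))
  have := le_of_tendsto_of_tendsto' hlim3 hlim4 hR
  simpa using this

/-- **Ladyzhenskaya's estimate with force, DATA FORM** (the bound that feeds the a-priori
enstrophy estimate of Lemarié-Rieusset 2016, Thm. 10.4, in the forced case): under the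
hypotheses of `ladyzhenskaya_weighted_estimate_forced` with, instead of the majorant `Ψ`, square
integrability of the force quotient `g(t) = (curl f(t))_θ/r` with `∫ g(t)² ≤ G₂` on `[0, T]`,
`∫ q(t)² ≤ 2 ∫ q(0)² + 4 T² G₂` for every `t ∈ [0, T]`.
Proof: with `M⋆ = sup_{[0,T]} ∫ q(s)²` (finite by `F⋆`) and Young's inequality
`|q||g| ≤ λq²/2 + g²/(2λ)`, `λ = 1/(2T)`, the estimate gives `∫ q(t)² ≤ ∫ q(0)² + M⋆/2 + 2T²G₂`
for all `t`, hence `M⋆ ≤ 2∫q(0)² + 4T²G₂`. [cite: LemarieRieusset2016, §10.3 Thm. 10.4 proof, (10.27) p. 288] -/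
theorem ladyzhenskaya_weighted_bound_forced (hT : 0 < T) (hν : 0 ≤ ν)
    (hsol : IsClassicalNSSolutionOn (Icc 0 T) ν f u p)
    (hax : ∀ t ∈ Icc 0 T, IsAxisymmetric (u t)) (hsw : ∀ t ∈ Icc 0 T, HasNoSwirl (u t))
    (hfax : ∀ t ∈ Icc 0 T, IsAxisymmetric (f t)) (hfsw : ∀ t ∈ Icc 0 T, HasNoSwirl (f t))
    {F G V Fstar G₂ : ℝ}
    (hF : ∀ t ∈ Icc 0 T, ∀ x, |hadamardQuotFst (fun y => curl (u t) y 1) x| ≤ F)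
    (hG : ∀ t ∈ Icc 0 T, ∀ x, ‖fderiv ℝ (hadamardQuotFst (fun y => curl (u t) y 1)) x‖ ≤ G)
    (hV : ∀ t ∈ Icc 0 T, ∀ x, ‖u t x‖ ≤ V)
    (hint : ∀ t ∈ Icc 0 T, Integrable (fun x => hadamardQuotFst (fun y => curl (u t) y 1) x ^ 2))
    (hFstar : ∀ t ∈ Icc 0 T, ∫ x, hadamardQuotFst (fun y => curl (u t) y 1) x ^ 2 ≤ Fstar)
    (hgint : ∀ t ∈ Icc 0 T, Integrable (fun x => hadamardQuotFst (fun y => curl (f t) y 1) x ^ 2))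
    (hG₂ : ∀ t ∈ Icc 0 T, ∫ x, hadamardQuotFst (fun y => curl (f t) y 1) x ^ 2 ≤ G₂) :
    ∀ t ∈ Icc 0 T, ∫ x, hadamardQuotFst (fun y => curl (u t) y 1) x ^ 2 ≤
      2 * (∫ x, hadamardQuotFst (fun y => curl (u 0) y 1) x ^ 2) + 4 * T ^ 2 * G₂ := by
  have hU : UniqueDiffOn ℝ (Icc 0 T) := uniqueDiffOn_Icc hT
  have h0T : (0 : ℝ) ∈ Icc 0 T := ⟨le_rfl, hT.le⟩
  set X : ℝ → ℝ := fun s => ∫ x, hadamardQuotFst (fun y => curl (u s) y 1) x ^ 2 with hXdef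
  have hX0 : ∀ s, 0 ≤ X s := fun s => integral_nonneg fun x => sq_nonneg _
  have hG₂0 : 0 ≤ G₂ := (integral_nonneg fun x => sq_nonneg _).trans (hG₂ 0 h0T)
  -- the supremum over the slab
  set M : ℝ := sSup (X '' Icc 0 T) with hMdef
  have hbdd : BddAbove (X '' Icc 0 T) := ⟨Fstar, by
    rintro _ ⟨s, hs, rfl⟩; exact hFstar s hs⟩
  have hne : (X '' Icc 0 T).Nonempty := ⟨X 0, ⟨0, h0T, rfl⟩⟩
  have hXM : ∀ s ∈ Icc 0 T, X s ≤ M := fun s hs => le_csSup hbdd ⟨s, hs, rfl⟩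
  have hM0 : 0 ≤ M := (hX0 0).trans (hXM 0 h0T)
  -- Young's inequality with `λ = 1/(2T)`
  set lam : ℝ := 1 / (2 * T) with hlam
  have hlam0 : 0 < lam := by positivity
  set Ψ : ℝ := (lam * M + G₂ / lam) / 2 with hΨdef
  have hΨi : ∀ t ∈ Icc 0 T, Integrable fun x => |hadamardQuotFst (fun y => curl (u t) y 1) x| *
      |hadamardQuotFst (fun y => curl (f t) y 1) x| := by
    intro t ht
    have hu3 : ContDiff ℝ 3 (u t) := (hsol.contDiff_velocity ht).of_le (by norm_cast)
    have hf3 : ContDiff ℝ 3 (f t) :=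
      ((hsol.isSmoothSpaceTimeOn_force hU).contDiff_slice ht).of_le (by norm_cast)
    have hq1 : ContDiff ℝ 1 (hadamardQuotFst (fun y => curl (u t) y 1)) :=
      contDiff_hadamardQuotFst_curl (n := 1) (by exact_mod_cast hu3)
    have hg1 : ContDiff ℝ 1 (hadamardQuotFst (fun y => curl (f t) y 1)) :=
      contDiff_hadamardQuotFst_curl (n := 1) (by exact_mod_cast hf3)
    have hsum : Integrable fun x => (lam / 2) * hadamardQuotFst (fun y => curl (u t) y 1) x ^ 2 +
        (1 / (2 * lam)) * hadamardQuotFst (fun y => curl (f t) y 1) x ^ 2 :=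
      ((hint t ht).const_mul _).add ((hgint t ht).const_mul _)
    refine hsum.mono' ((continuous_abs.comp hq1.continuous).mul
      (continuous_abs.comp hg1.continuous)).aestronglyMeasurable (ae_of_all _ fun x => ?_)
    rw [Real.norm_eq_abs, abs_of_nonneg (by positivity)]
    set a := |hadamardQuotFst (fun y => curl (u t) y 1) x|
    set b := |hadamardQuotFst (fun y => curl (f t) y 1) x|
    have ha : 0 ≤ a := abs_nonneg _
    have hb : 0 ≤ b := abs_nonneg _
    have key : a * b ≤ lam / 2 * a ^ 2 + 1 / (2 * lam) * b ^ 2 := by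
      have h1 : 0 ≤ (lam * a - b) ^ 2 := sq_nonneg _
      have e : lam / 2 * a ^ 2 + 1 / (2 * lam) * b ^ 2 - a * b = (lam * a - b) ^ 2 / (2 * lam) := by
        field_simp
        ring
      have : 0 ≤ lam / 2 * a ^ 2 + 1 / (2 * lam) * b ^ 2 - a * b := by
        rw [e]; positivity
      linarith
    calc a * b ≤ lam / 2 * a ^ 2 + 1 / (2 * lam) * b ^ 2 := key
      _ = _ := by rw [sq_abs, sq_abs]
  have hΨ : ∀ t ∈ Icc 0 T, ∫ x, |hadamardQuotFst (fun y => curl (u t) y 1) x| *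
      |hadamardQuotFst (fun y => curl (f t) y 1) x| ≤ Ψ := by
    intro t ht
    have hsum : Integrable fun x => (lam / 2) * hadamardQuotFst (fun y => curl (u t) y 1) x ^ 2 +
        (1 / (2 * lam)) * hadamardQuotFst (fun y => curl (f t) y 1) x ^ 2 :=
      ((hint t ht).const_mul _).add ((hgint t ht).const_mul _)
    have hpt : ∀ x, |hadamardQuotFst (fun y => curl (u t) y 1) x| *
        |hadamardQuotFst (fun y => curl (f t) y 1) x| ≤
        (lam / 2) * hadamardQuotFst (fun y => curl (u t) y 1) x ^ 2 +
          (1 / (2 * lam)) * hadamardQuotFst (fun y => curl (f t) y 1) x ^ 2 := by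
      intro x
      set a := |hadamardQuotFst (fun y => curl (u t) y 1) x|
      set b := |hadamardQuotFst (fun y => curl (f t) y 1) x|
      have key : a * b ≤ lam / 2 * a ^ 2 + 1 / (2 * lam) * b ^ 2 := by
        have e : lam / 2 * a ^ 2 + 1 / (2 * lam) * b ^ 2 - a * b =
            (lam * a - b) ^ 2 / (2 * lam) := by
          field_simp
          ring
        have : 0 ≤ lam / 2 * a ^ 2 + 1 / (2 * lam) * b ^ 2 - a * b := by
          rw [e]; positivity
        linarith
      calc a * b ≤ lam / 2 * a ^ 2 + 1 / (2 * lam) * b ^ 2 := key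
        _ = _ := by rw [sq_abs, sq_abs]
    calc _ ≤ ∫ x, (lam / 2) * hadamardQuotFst (fun y => curl (u t) y 1) x ^ 2 +
          (1 / (2 * lam)) * hadamardQuotFst (fun y => curl (f t) y 1) x ^ 2 :=
          integral_mono (hΨi t ht) hsum hpt
      _ = (lam / 2) * X t + (1 / (2 * lam)) *
          ∫ x, hadamardQuotFst (fun y => curl (f t) y 1) x ^ 2 := by
          rw [integral_add ((hint t ht).const_mul _) ((hgint t ht).const_mul _),
            integral_const_mul, integral_const_mul]
      _ ≤ (lam / 2) * M + (1 / (2 * lam)) * G₂ := by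
          gcongr
          · exact hXM t ht
          · exact hG₂ t ht
      _ = Ψ := by rw [hΨdef]; ring
  -- the estimate with this `Ψ`, at every time, and the supremum
  have hest := ladyzhenskaya_weighted_estimate_forced hT hν hsol hax hsw hfax hfsw hF hG hV hint
    hFstar hΨi hΨ
  have hΨ0 : 0 ≤ Ψ := by positivity
  have hMle : M ≤ X 0 + 2 * T * Ψ := by
    refine csSup_le hne ?_
    rintro _ ⟨s, hs, rfl⟩
    have h1 := hest s hs
    have h2 : 2 * s * Ψ ≤ 2 * T * Ψ := by
      have := hs.2
      gcongr
    exact h1.trans (by linarith)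
  -- `2TΨ = M/2 + 2T²G₂`
  have hTΨ : 2 * T * Ψ = M / 2 + 2 * T ^ 2 * G₂ := by
    rw [hΨdef, hlam]
    have hT0 : T ≠ 0 := hT.ne'
    field_simp
  intro t ht
  have h := hXM t ht
  rw [hTΨ] at hMle
  change X t ≤ 2 * X 0 + 4 * T ^ 2 * G₂
  linarith

end Main

end Literature.Analysis.FluidPDE

end
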